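import Summits.QuantumAdvantage.QuantumAdvantage.Theorems.NearExactIsExact.Negative.CaseAFrameFreeFourteen

/-!
# A type-O side caps the forrelation at `61/64` on 14 bits (NearExactIsExact, disprover gen 24)

Negative/structural theorem for the crux `CubicForrelation.NearExactIsExact` (item r2), finite slice `n = 14`.
HONEST FRAMING: a statement about cubic Boolean functions on 14 bits — NOT summit progress; no violation of
`NearExactIsExact`, no per-`n` value of `θ`.

Setting: `g` cubic on `14` bits of TYPE O (`W_g = 32u`, every `u(x)` odd), digits `d₁ = [⌊u/2⌋ odd]` (quadratic, `fd_digitOne`),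
`d₂ = [⌊u/4⌋ odd]` (degree `≤ 4`, `fd_digitTwo`), `E = {d₁ = d₂}`.
* `to61_E_nonempty_le`: if `E ≠ ∅` then `Φ(f,g) ≤ 61/64` for EVERY Boolean `f`: `E` is the support of the non-zero word
  `1 ⊕ d₁ ⊕ d₂ ∈ RM(4,14)`, so `#E ≥ 2¹⁰`; the budget `Σ_x (u − 4(−1)^f)² = 2¹⁹(1 − Φ)` pays `≥ 1` per point and `≥ 9` per point of
  `E` (`tw12_pt`), so `2¹⁹(1 − Φ) ≥ 2¹⁴ + 2¹³`.
* `typeO_forrelation_le_61`: for cubic `f`, a type-O `g` gives `Φ(f,g) ≤ 61/64` (if `E = ∅` the pair is in case A and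
  `caseA_forrelation_le` gives `59/64`); `typeO_forrelation_le_61'` is the same with the type-O side `f`.
Consequence (assembled in `…Negative.ThetaFourteenSixtyOne`): above `61/64` both sides of a non-exact cubic pair are at level 6.

Sources: [this work]; tools from the tree as cited inline.  Standard axioms only.
-/

set_option linter.dupNamespace false -- D-0017: single-problem summit ⇒ `QuantumAdvantage.QuantumAdvantage` by design

noncomputable section

namespace Summit.QuantumAdvantage.QuantumAdvantage.Theorems.NearExactIsExact.Negative.TypeOSixtyOneFourteen

open Finset
open Literature.Computability.QuantumComplexity
open Literature.Computability.QuantumComplexity.DerivativeWalsh (W)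
open Summit.QuantumAdvantage.QuantumAdvantage.Theorems.CubicForrelation.NearExactIsExact
open Summit.QuantumAdvantage.QuantumAdvantage.Theorems.SignedCubicForrelationNotPrBPP.Negative.HalfQuad (forrelation_comm)
open Summit.QuantumAdvantage.QuantumAdvantage.Theorems.NearExactIsExact.Negative.CaseAFrameFreeFourteen
  (caseA_forrelation_le)

/-- **Type O with `E ≠ ∅` costs `3/64`.**  For cubic `g` on `14` bits with `W_g = 32u`, all `u(x)` odd, and some point where the
digits `[⌊u/2⌋ odd]`, `[⌊u/4⌋ odd]` agree, every Boolean `f` has `Φ(f,g) ≤ 61/64` (`#E ≥ 2¹⁰` by `RM(4,14)`, budget + `tw12_pt`).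
NOT summit progress. [this work] -/
theorem to61_E_nonempty_le (f g : (Fin (7 + 7) → Bool) → Bool) (hg : IsDegLeFun 3 g)
    (u : (Fin (7 + 7) → Bool) → ℤ) (hu : ∀ x, W (fun y => signOf (g y)) x = (2 : ℝ) ^ 5 * (u x : ℝ))
    (hodd : ∀ x, Odd (u x)) (hEne : ∃ x, (Odd (u x / 2) ↔ Odd (u x / 2 / 2))) :
    forrelation f g ≤ 61 / 64 := by
  classical
  have hd1 : IsDegLeFun 2 (fun x => decide (Odd (u x / 2))) := fd_digitOne g u hg hu
  have hd2 : IsDegLeFun 4 (fun x => decide (Odd (u x / 2 / 2))) := fd_digitTwo g u hg hu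
  set E := univ.filter (fun x : Fin (7 + 7) → Bool => (Odd (u x / 2) ↔ Odd (u x / 2 / 2))) with hEdef
  -- `E` is the support of a non-zero word of `RM(4,14)`
  have hdegE : IsDegLeFun 4 (fun x => (decide (Odd (u x / 2)) ^^ decide (Odd (u x / 2 / 2))) ^^ true) :=
    tb_isDegLeFun_xor_const (bb_isDegLeFun_bxor (hd1.mono (by norm_num)) hd2) true
  have hsetE : (univ.filter fun x : Fin (7 + 7) → Bool =>
      ((decide (Odd (u x / 2)) ^^ decide (Odd (u x / 2 / 2))) ^^ true) = true) = E := by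
    rw [hEdef]
    apply filter_congr
    intro x _
    by_cases h1 : Odd (u x / 2) <;> by_cases h2 : Odd (u x / 2 / 2) <;> simp [h1, h2]
  have hne : ∃ x, ((decide (Odd (u x / 2)) ^^ decide (Odd (u x / 2 / 2))) ^^ true) = true := by
    obtain ⟨x, hx⟩ := hEne
    refine ⟨x, ?_⟩
    by_cases h1 : Odd (u x / 2) <;> by_cases h2 : Odd (u x / 2 / 2) <;> simp [h1, h2] at hx ⊢
  have hrm := bb_rmWeight_holds (7 + 7) 4 _ hdegE hne
  rw [hsetE] at hrm
  have hEge : 1024 ≤ #E := by norm_num at hrm; omega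
  -- budget and the pointwise cost
  have hbud := fl_budget5 f g u hu
  have hsumE : (∑ x, (if (Odd (u x / 2) ↔ Odd (u x / 2 / 2)) then 1 else 0 : ℤ)) = #E := by rw [sum_boole]
  have hpt : ∀ x, 1 + 8 * (if (Odd (u x / 2) ↔ Odd (u x / 2 / 2)) then 1 else 0 : ℤ) ≤ (u x - 4 * sZ (f x)) ^ 2 :=
    fun x => tw12_pt (u x) (sZ (f x)) (hodd x) (tp_sZ_cases (f x))
  have hlow : (16384 : ℤ) + 8 * #E ≤ ∑ x, (u x - 4 * sZ (f x)) ^ 2 := by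
    have h := sum_le_sum fun x (_ : x ∈ (univ : Finset (Fin (7 + 7) → Bool))) => hpt x
    rw [sum_add_distrib, ← mul_sum, hsumE, sum_const, card_univ, Fintype.card_fun, Fintype.card_bool,
      Fintype.card_fin] at h
    norm_num at h
    linarith
  have hlowR : (24576 : ℝ) ≤ ((∑ x, (u x - 4 * sZ (f x)) ^ 2 : ℤ) : ℝ) := by
    have h' : (24576 : ℤ) ≤ ∑ x, (u x - 4 * sZ (f x)) ^ 2 := by
      have : (1024 : ℤ) ≤ #E := by exact_mod_cast hEge
      linarith
    exact_mod_cast h'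
  rw [hbud] at hlowR
  linarith

/-- **THEOREM TypeO61.**  For cubic `f, g` on `14` bits with `g` of type O (`W_g = 32u`, all `u(x)` odd): `Φ(f,g) ≤ 61/64`.
(`E ≠ ∅`: `to61_E_nonempty_le`; `E = ∅` is case A: `caseA_forrelation_le` gives `59/64`.)  The tree's structure theorem
`fo_second_structure_sharp` left type-O pairs of digit rank `≥ 4` open in `[15/16, 1)`; this closes all of `(61/64, 1)` for them.
NOT summit progress. [this work] -/
theorem typeO_forrelation_le_61 (f g : (Fin (7 + 7) → Bool) → Bool) (hf : IsDegLeFun 3 f) (hg : IsDegLeFun 3 g)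
    (u : (Fin (7 + 7) → Bool) → ℤ) (hu : ∀ x, W (fun y => signOf (g y)) x = (2 : ℝ) ^ 5 * (u x : ℝ))
    (hodd : ∀ x, Odd (u x)) : forrelation f g ≤ 61 / 64 := by
  by_cases hE : ∃ x, (Odd (u x / 2) ↔ Odd (u x / 2 / 2))
  · exact to61_E_nonempty_le f g hg u hu hodd hE
  · exact (caseA_forrelation_le f g hf hg u hu hodd fun x h => hE ⟨x, h⟩).trans (by norm_num)

/-- **THEOREM TypeO61, the type-O side being `f`.**  NOT summit progress. [this work] -/
theorem typeO_forrelation_le_61' (f g : (Fin (7 + 7) → Bool) → Bool) (hf : IsDegLeFun 3 f) (hg : IsDegLeFun 3 g)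
    (v : (Fin (7 + 7) → Bool) → ℤ) (hv : ∀ y, W (fun x => signOf (f x)) y = (2 : ℝ) ^ 5 * (v y : ℝ))
    (hodd : ∀ y, Odd (v y)) : forrelation f g ≤ 61 / 64 := by
  rw [forrelation_comm]
  exact typeO_forrelation_le_61 g f hg hf v hv hodd

/-- **No type-O side above `61/64`.**  A cubic pair on `14` bits with `61/64 < Φ(f,g)` has NO type-O side: writing `W_g = 32u_g`,
`W_f = 32u_f` (Ax), some `u_g(x)` and some `u_f(y)` are even.  NOT summit progress. [this work] -/
theorem no_typeO_above_61 (f g : (Fin (7 + 7) → Bool) → Bool) (hf : IsDegLeFun 3 f) (hg : IsDegLeFun 3 g)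
    (hΦ : (61 / 64 : ℝ) < forrelation f g)
    (ug uf : (Fin (7 + 7) → Bool) → ℤ) (hug : ∀ x, W (fun y => signOf (g y)) x = (2 : ℝ) ^ 5 * (ug x : ℝ))
    (huf : ∀ y, W (fun x => signOf (f x)) y = (2 : ℝ) ^ 5 * (uf y : ℝ)) :
    (∃ x, ¬ Odd (ug x)) ∧ (∃ y, ¬ Odd (uf y)) := by
  constructor
  · by_contra h
    push Not at h
    exact absurd hΦ (not_lt.2 (typeO_forrelation_le_61 f g hf hg ug hug h))
  · by_contra h
    push Not at h
    exact absurd hΦ (not_lt.2 (typeO_forrelation_le_61' f g hf hg uf huf h))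

end Summit.QuantumAdvantage.QuantumAdvantage.Theorems.NearExactIsExact.Negative.TypeOSixtyOneFourteen

end
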